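import Mathlib
import HarnessLib
import Literature.Analysis.FluidPDE.TypeIAncientMild
import Literature.Analysis.FluidPDE.OseenKernelLp
import Literature.Analysis.FluidPDE.KatoLocalBoundedPicard
import Literature.Analysis.FluidPDE.NSBoundedMildSmoothing
import Literature.Analysis.UnboundedOperators.HeatKernel
import Literature.Analysis.UnboundedOperators.HeatKernelBoundedData
import Summits.NavierStokesRegularity.NavierStokesRegularity.Theorems.QuarterLogPincerThinCascadeDefs
import Summits.NavierStokesRegularity.NavierStokesRegularity.Theorems.QuarterLogPincerQuietCollarDefs
import Summits.NavierStokesRegularity.NavierStokesRegularity.Theorems.QuarterLogPincerQuietCollarDefectRestart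
import Summits.NavierStokesRegularity.NavierStokesRegularity.Theorems.QuarterLogPincerQuietCollarShadowingTools
import Summits.NavierStokesRegularity.NavierStokesRegularity.Theorems.QuarterLogPincerTruncationEdgeOseenStability
import Summits.NavierStokesRegularity.NavierStokesRegularity.Theorems.QuarterLogPincerTruncationEdgeShadowing

/-!
# Route `QuarterLogPincer`, crux `TypeIQuantSubcubicExp` (stmt-NavierStokesRegularity-24077), line `quiet_collar` —
# QP3 BY NAME: `stub_forcedTwoNormShadowing : StubForcedTwoNormShadowing` (forced two-norm shadowing with polynomial loss)

The registered-form obligation QP3 of ns-idea-7 g9's LOOP line `quiet_collar` v1.1 (`Cruxes/TypeIQuantSubcubicExp/Lines/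
quiet_collar.lean`, tree sha16 `8170489f8bcaaff9`; critic of record idea-crit-4 g6; DIRECTOR-NS dss_121, typer's default after (B)),
proved against the re-homed objects of `Theorems/QuarterLogPincerQuietCollarDefs.lean` (`ForcedTwoNormShadowing`,
`StubForcedTwoNormShadowing`, `mildDefect`; bodies verbatim = the line's), so the line can import it and delete its `sorry`:
pure finite-time perturbation theory of ONE Tao-frame solution `u` around a Type-I reference `V` (rate `M(1−t)^{−1/2}`) with a mild
defect, `κ = m+1`, `m = ⌈64C²(M+2)²⌉`, `K = 4(C₂+1)·5·2^{m+1} + 8(C₂+1) + 4`: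

* SUP: `…ShadowingTools.exists_forcedSupShadowing` (`5η(2/(1−t))^{m+1} ≤ 5·2^{m+1}ε^{−(m+1)}η`; the dyadic Type-I chain of
  `…QuasiMildStability` fed by the restarted defect of `…DefectRestart`);
* `L³` (LOSSLESS once the sup distance is small): `w = e^{tΔ}w₀ − B₀(w,u) − B₀(V,w) − D` in `L³` — heat contraction
  `eLpNorm_heatExtension_le_holds`, the Duhamel step `…ShadowingTools.eLpNorm_oseenDuhamel_three_le` (Minkowski, slice Young at
  `p = q = 3`, Hölder `∞ × 3`) — gives the linear Volterra inequality `‖w(t)‖₃ ≤ 2β + 4C₂θ_s b + 2C₂θ_s·sup‖w‖₃`; the hypothesis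
  `Kε^{−κ}η ≤ 1` forces the sup distance `θ_s ≤ 1/(4(C₂+1))`, so the step is absorbed, started from the finite a-priori `L³` level of a
  Tao-frame solution (`L² ∩ L^∞ ⊂ L³`), whence `‖w(t)‖₃ ≤ 4β + 8C₂θ_s b ≤ K(β + b·Kε^{−κ}η)`.

With QP1 (p679082) and QP3 (this file) landed, the line's Q1 anatomy `farFieldTruncation_of_quietAnatomy : QP1 → QP2 → QP3 → P2 →
FarFieldTruncation M v` has ONLY QP2 `stub_cutPair` open (P2 = landed `TruncationEdge.stub_frameBootstrap`).  HONEST FRAME: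
perturbation theory about ONE hypothetical smooth solution; nothing here bears on 24077's truth (CAPPED, T2), the envelope-class
Liouville wall, the DSS wall W7 or Navier–Stokes regularity (OPEN / not proved).  pub-ns-dss typer (g36), `--supports 24077`.
-/

noncomputable section

set_option linter.dupNamespace false

namespace Summit.NavierStokesRegularity.NavierStokesRegularity.Cruxes.TypeIQuantSubcubicExp.QuietCollar

open MeasureTheory Set Function Filter Real Metric
open scoped ENNReal NNReal Topology
open Literature.Analysis Literature.Analysis.FluidPDE
open Summit.NavierStokesRegularity.NavierStokesRegularity.Theorems.QuarterLogPincerTruncationEdge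
  (continuous_slice_of_continuousOn_slab aestronglyMeasurable_of_continuousOn_slab taoFrame_mild_eq)
open Summit.NavierStokesRegularity.NavierStokesRegularity.Cruxes.TypeIQuantSubcubicExp.ThinCascade (TaoFrame)

/-! ## QP3 BY NAME -/

/-- **QP3 — FORCED TWO-NORM SHADOWING WITH POLYNOMIAL LOSS (`stub_forcedTwoNormShadowing : StubForcedTwoNormShadowing`, the
registered form of `ForcedTwoNormShadowing` of line `quiet_collar` v1.1, BY NAME).**  `κ = m + 1`, `m = ⌈64C²(M+2)²⌉`, and
`K = 4(C₂+1)·5·2^{m+1} + 8(C₂+1) + 4` with `C` the step constant of `…QuietCollarQuasiMildStability` and `C₂` the `L³` slice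
constant of the Oseen tensor: the SUP clause is `exists_forcedSupShadowing` (`5η(2/(1−t))^{m+1} ≤ 5·2^{m+1}ε^{−(m+1)}η`); the
`L³` clause is the linear Volterra step `‖w(t)‖₃ ≤ 2β + 4C₂θ_s b + 2C₂θ_s·sup‖w‖₃` (heat `L³` contraction, Minkowski, slice Young,
Hölder `∞ × 3`), absorbed because the hypothesis `Kε^{−κ}η ≤ 1` forces the sup distance `θ_s ≤ 1/(4(C₂+1))`, started from the
finite a-priori `L³` level of a Tao-frame solution (interpolation `L² ∩ L^∞ ⊂ L³`). [folklore; Kato–Fujita perturbation theory] -/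
theorem stub_forcedTwoNormShadowing : StubForcedTwoNormShadowing := by
  intro M hM
  obtain ⟨C, hC, hsup⟩ := exists_forcedSupShadowing
  obtain ⟨C₂, hC₂0, hS₂⟩ := exists_eLpNorm_oseenSlice_le (E := EuclideanSpace ℝ (Fin 3)) (p := 3) (q := 3)
    (by norm_num) (by norm_num) le_rfl
  set m : ℕ := ⌈64 * C ^ 2 * (M + 2) ^ 2⌉₊ with hm
  obtain ⟨Ks, hKs⟩ : ∃ Ks : ℝ, Ks = 5 * 2 ^ (m + 1) := ⟨_, rfl⟩
  obtain ⟨K, hK⟩ : ∃ K : ℝ, K = 4 * (C₂ + 1) * Ks + 8 * (C₂ + 1) + 4 := ⟨_, rfl⟩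
  have hKs0 : 0 < Ks := by rw [hKs]; positivity
  have hKsK : Ks ≤ K := by rw [hK]; nlinarith
  have hK4 : 4 ≤ K := by rw [hK]; nlinarith
  have hK8 : 8 * C₂ ≤ K := by rw [hK]; nlinarith
  have hKq : 4 * (C₂ + 1) * Ks ≤ K := by rw [hK]; nlinarith
  refine ⟨((m + 1 : ℕ) : ℝ), K, by positivity, by linarith, ?_⟩
  intro ε hε η hη V hVc hVrate _hVsupp hVdef u₀ hu₀ T' hT' u p hu hu0 hclose
  have hε0 : 0 < ε := hε.1
  have hε1 : ε ≤ 1 := by linarith [hε.2]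
  have hTend : 0 < 1 - ε := by linarith [hε.2]
  have hT'0 : 0 < T' := hT'.1
  have hT'1 : T' ≤ 1 - ε := hT'.2
  have hpow : ε ^ (-((m + 1 : ℕ) : ℝ)) = (ε ^ (m + 1))⁻¹ := by rw [Real.rpow_neg hε0.le, Real.rpow_natCast]
  have hpow0 : 0 ≤ ε ^ (-((m + 1 : ℕ) : ℝ)) := Real.rpow_nonneg hε0.le _
  -- ### the sup clause
  have hsupB : ∀ t ∈ Set.Icc 0 T', ∀ x, ‖u t x - V t x‖ ≤ Ks * ε ^ (-((m + 1 : ℕ) : ℝ)) * η := by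
    intro t ht x
    refine (hsup hM hε hη hVc hVrate hVdef hu₀ hT' hu hu0 hclose t ht x).trans ?_
    have h1t : ε ≤ 1 - t := by linarith [ht.2]
    have hq : 2 / (1 - t) ≤ 2 / ε := div_le_div_of_nonneg_left (by norm_num) hε0 h1t
    have hq0 : 0 ≤ 2 / (1 - t) := by have : 0 < 1 - t := by linarith [ht.2]
                                     positivity
    calc 5 * η * (2 / (1 - t)) ^ (m + 1) ≤ 5 * η * (2 / ε) ^ (m + 1) := by gcongr
      _ = Ks * ε ^ (-((m + 1 : ℕ) : ℝ)) * η := by rw [hpow, hKs, div_pow]; field_simp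
  obtain ⟨θs, hθs⟩ : ∃ θs : ℝ, θs = Ks * ε ^ (-((m + 1 : ℕ) : ℝ)) * η := ⟨_, rfl⟩
  have hθs0 : 0 ≤ θs := by rw [hθs]; positivity
  refine ⟨fun t ht x => (hsupB t ht x).trans
    (mul_le_mul_of_nonneg_right (mul_le_mul_of_nonneg_right hKsK hpow0) hη), ?_⟩
  -- ### the L³ clause
  intro β b hβ hb hθ1 hw0 hD3 hV3 t ht
  obtain ⟨θ, hθ⟩ : ∃ θ : ℝ, θ = K * ε ^ (-((m + 1 : ℕ) : ℝ)) * η := ⟨_, rfl⟩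
  rw [← hθ] at hθ1 ⊢
  have hθ0 : 0 ≤ θ := by rw [hθ]; exact mul_nonneg (mul_nonneg (by linarith) hpow0) hη
  have hθsθ : θs ≤ θ := by
    rw [hθs, hθ]; exact mul_le_mul_of_nonneg_right (mul_le_mul_of_nonneg_right hKsK hpow0) hη
  -- the sup distance is small: `2 C₂ θs ≤ 1/2`
  have hsmall : 2 * C₂ * θs ≤ 1 / 2 := by
    have h1 : 4 * (C₂ + 1) * θs ≤ θ := by
      have : 4 * (C₂ + 1) * θs = (4 * (C₂ + 1) * Ks) * ε ^ (-((m + 1 : ℕ) : ℝ)) * η := by rw [hθs]; ring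
      rw [this, hθ]
      exact mul_le_mul_of_nonneg_right (mul_le_mul_of_nonneg_right hKq hpow0) hη
    have h2 : 4 * (C₂ + 1) * θs ≤ 1 := h1.trans hθ1
    have h3 : 2 * C₂ * θs ≤ 2 * (C₂ + 1) * θs := by nlinarith
    linarith
  -- continuity / bounds of the fields on the slab `[0,T']`
  have hcu : ContinuousOn (uncurry u) (Set.Icc 0 T' ×ˢ Set.univ) := hu.1.smooth_velocity.continuousOn
  have hcV : ContinuousOn (uncurry V) (Set.Icc 0 T' ×ˢ Set.univ) :=
    hVc.mono (prod_mono (Icc_subset_Icc le_rfl hT'1) subset_rfl)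
  have hcw : ContinuousOn (uncurry fun τ y => u τ y - V τ y) (Set.Icc 0 T' ×ˢ Set.univ) := hcu.sub hcV
  set BV : ℝ := M * ε ^ (-(1 / 2 : ℝ)) with hBV
  have hBV0 : 0 ≤ BV := by positivity
  have hVB : ∀ t ∈ Set.Icc 0 (1 - ε), ∀ x, ‖V t x‖ ≤ BV := by
    intro t ht x
    refine (hVrate t ht x).trans (mul_le_mul_of_nonneg_left ?_ hM)
    exact Real.rpow_le_rpow_of_nonpos hε0 (by linarith [ht.2]) (by norm_num)
  have hVB' : ∀ t ∈ Set.Icc 0 T', ∀ x, ‖V t x‖ ≤ BV := fun t ht x => hVB t ⟨ht.1, ht.2.trans hT'1⟩ x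
  have huB : ∀ t ∈ Set.Icc 0 T', ∀ x, ‖u t x‖ ≤ BV + 2 := by
    intro t ht x
    have h1 := hclose t ht x
    have h2 := norm_le_norm_add_norm_sub' (u t x) (V t x)
    rw [norm_sub_rev] at h2
    linarith [hVB' t ht x, norm_sub_rev (u t x) (V t x)]
  have hwB : ∀ t ∈ Set.Icc 0 T', ∀ x, ‖u t x - V t x‖ ≤ θs := fun t ht x => by rw [hθs]; exact hsupB t ht x
  -- `L³` sizes: a priori finiteness for `u`, and `‖u(σ)‖₃ ≤ b + ‖w(σ)‖₃`
  obtain ⟨C0, hC0⟩ := hu.2 0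
  have hu2 : ∀ σ ∈ Set.Icc 0 T', eLpNorm (u σ) 2 volume ≤ C0 := by
    intro σ hσ
    have h := hC0 σ hσ
    rwa [eLpNorm_congr_norm_ae (Eventually.of_forall fun x => norm_iteratedFDeriv_zero (𝕜 := ℝ) (f := u σ) (x := x))] at h
  set n : ℝ → ℝ≥0∞ := fun σ => eLpNorm (fun x => u σ x - V σ x) 3 volume with hn
  set N₀ : ℝ≥0∞ := (ENNReal.ofReal (BV + 2) * (C0 : ℝ≥0∞) ^ 2) ^ (1 / (3 : ℝ)) + ENNReal.ofReal b with hN₀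
  have hN₀top : N₀ ≠ ⊤ := by
    refine ENNReal.add_ne_top.2 ⟨?_, ENNReal.ofReal_ne_top⟩
    exact ENNReal.rpow_ne_top_of_nonneg (by norm_num)
      (ENNReal.mul_ne_top ENNReal.ofReal_ne_top (ENNReal.pow_ne_top ENNReal.coe_ne_top))
  have hmeas_u : ∀ σ ∈ Set.Icc 0 T', AEStronglyMeasurable (u σ) volume :=
    fun σ hσ => (continuous_slice_of_continuousOn_slab hcu hσ).aestronglyMeasurable
  have hmeas_V : ∀ σ ∈ Set.Icc 0 T', AEStronglyMeasurable (V σ) volume :=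
    fun σ hσ => (continuous_slice_of_continuousOn_slab hcV hσ).aestronglyMeasurable
  have hmeas_w : ∀ σ ∈ Set.Icc 0 T', AEStronglyMeasurable (fun x => u σ x - V σ x) volume :=
    fun σ hσ => (hmeas_u σ hσ).sub (hmeas_V σ hσ)
  have hn0 : ∀ σ ∈ Set.Icc 0 T', n σ ≤ N₀ := by
    intro σ hσ
    have h1 : n σ ≤ eLpNorm (u σ) 3 volume + eLpNorm (V σ) 3 volume := eLpNorm_sub_le (hmeas_u σ hσ) (hmeas_V σ hσ) (by norm_num)
    refine h1.trans (add_le_add ?_ (hV3 σ ⟨hσ.1, hσ.2.trans hT'1⟩))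
    exact eLpNorm_three_le_of_bound_of_two (huB σ hσ) (hu2 σ hσ)
  have hu3 : ∀ X : ℝ≥0∞, (∀ σ ∈ Set.Icc 0 T', n σ ≤ X) → ∀ σ ∈ Set.Icc 0 T', eLpNorm (u σ) 3 volume ≤ ENNReal.ofReal b + X := by
    intro X hX σ hσ
    have heq : u σ = fun x => V σ x + (u σ x - V σ x) := by funext x; abel
    rw [heq]
    exact (eLpNorm_add_le (hmeas_V σ hσ) (hmeas_w σ hσ) (by norm_num)).trans
      (add_le_add (hV3 σ ⟨hσ.1, hσ.2.trans hT'1⟩) (hX σ hσ))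
  -- ### the improvement step
  obtain ⟨q, hq⟩ : ∃ q : ℝ≥0∞, q = 2 * ENNReal.ofReal C₂ * ENNReal.ofReal θs := ⟨_, rfl⟩
  obtain ⟨S, hS⟩ : ∃ S : ℝ≥0∞, S = 2 * ENNReal.ofReal β + 2 * (q * ENNReal.ofReal b) := ⟨_, rfl⟩
  have hqreal : q = ENNReal.ofReal (2 * C₂ * θs) := by
    rw [hq, ENNReal.ofReal_mul (by positivity), ENNReal.ofReal_mul (by norm_num), ENNReal.ofReal_ofNat]
  have hq2 : 2 * q ≤ 1 := by
    rw [hqreal, ← ENNReal.ofReal_ofNat 2, ← ENNReal.ofReal_mul (by norm_num), ← ENNReal.ofReal_one]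
    exact ENNReal.ofReal_le_ofReal (by linarith)
  have himp : ∀ X : ℝ≥0∞, (∀ σ ∈ Set.Icc 0 T', n σ ≤ X) → ∀ t ∈ Set.Icc 0 T', n t ≤ S + q * X := by
    intro X hX t ht
    rcases ht.1.eq_or_lt with h0 | ht0
    · -- `t = 0`: the datum
      subst h0
      have : n 0 ≤ ENNReal.ofReal β := by
        have e : (fun x => u 0 x - V 0 x) = fun x => u₀ x - V 0 x := by rw [hu0]
        show eLpNorm (fun x => u 0 x - V 0 x) 3 volume ≤ ENNReal.ofReal β
        rw [e]; exact hw0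
      refine this.trans ?_
      rw [hS]
      have : ENNReal.ofReal β ≤ 2 * ENNReal.ofReal β := by rw [two_mul]; exact le_self_add
      exact this.trans (le_self_add.trans le_self_add)
    have htT : t ≤ T' := ht.2
    have ht1 : t ≤ 1 := by linarith
    -- the four pieces
    have hmu0 : ∀ x, u t x = heatFlow u₀ t x - oseenDuhamel 1 0 u u t x := by
      intro x
      have := taoFrame_mild_eq hu 0 t le_rfl ht0 htT x
      rwa [hu0, sub_zero] at this
    have hVdef0 : ∀ x, V t x = heatFlow (V 0) t x - oseenDuhamel 1 0 V V t x + mildDefect V t x := by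
      intro x
      have : mildDefect V t x = V t x - heatFlow (V 0) t x + oseenDuhamel 1 0 V V t x := rfl
      rw [this]; abel
    have hu₀c : Continuous u₀ := by
      rw [← hu0]; exact continuous_slice_of_continuousOn_slab hcu ⟨le_rfl, hT'0.le⟩
    have hV0c : Continuous (V 0) := continuous_slice_of_continuousOn_slab hcV ⟨le_rfl, hT'0.le⟩
    have hu₀B : ∀ y, ‖u₀ y‖ ≤ BV + 2 := fun y => by rw [← hu0]; exact huB 0 ⟨le_rfl, hT'0.le⟩ y
    have hV0B : ∀ y, ‖V 0 y‖ ≤ BV := fun y => hVB' 0 ⟨le_rfl, hT'0.le⟩ y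
    have hheat : ∀ x, heatFlow u₀ t x - heatFlow (V 0) t x = UnboundedOperators.heatExtension (fun y => u₀ y - V 0 y) t x := by
      intro x
      rw [heatFlow_of_pos _ ht0, heatFlow_of_pos _ ht0, UnboundedOperators.heatExtension_sub_of_bound hu₀c hV0c hu₀B hV0B ht0 x]
    have hmu' := aestronglyMeasurable_of_continuousOn_slab hcu le_rfl le_rfl
    have hmV' := aestronglyMeasurable_of_continuousOn_slab hcV le_rfl le_rfl
    have huB'' : ∀ τ ∈ Ioo 0 T', ∀ y, ‖u τ y‖ ≤ BV + 2 := fun τ hτ y => huB τ ⟨hτ.1.le, hτ.2.le⟩ y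
    have hVB'' : ∀ τ ∈ Ioo 0 T', ∀ y, ‖V τ y‖ ≤ BV + 2 := fun τ hτ y => (hVB' τ ⟨hτ.1.le, hτ.2.le⟩ y).trans (by linarith)
    have hsplit : ∀ x, oseenDuhamel 1 0 u u t x - oseenDuhamel 1 0 V V t x =
        oseenDuhamel 1 0 (fun τ y => u τ y - V τ y) u t x + oseenDuhamel 1 0 V (fun τ y => u τ y - V τ y) t x :=
      fun x => oseenDuhamel_self_sub_self (ν := (1:ℝ)) one_pos hmu' hmV' huB'' hVB'' ht0 htT x
    have hwt : (fun x => u t x - V t x) = fun x =>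
        UnboundedOperators.heatExtension (fun y => u₀ y - V 0 y) t x -
          (oseenDuhamel 1 0 (fun τ y => u τ y - V τ y) u t x + oseenDuhamel 1 0 V (fun τ y => u τ y - V τ y) t x) -
          mildDefect V t x := by
      funext x
      rw [hmu0 x, hVdef0 x, ← hheat x, ← hsplit x]
      abel
    -- `L³` bounds of the four pieces
    have hw0c : Continuous (fun y => u₀ y - V 0 y) := hu₀c.sub hV0c
    have hw0mem : MemLp (fun y => u₀ y - V 0 y) 3 volume :=
      ⟨hw0c.aestronglyMeasurable, lt_of_le_of_lt hw0 ENNReal.ofReal_lt_top⟩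
    have hf1 : eLpNorm (UnboundedOperators.heatExtension (fun y => u₀ y - V 0 y) t) 3 volume ≤ ENNReal.ofReal β :=
      (UnboundedOperators.eLpNorm_heatExtension_le_holds hw0mem (by norm_num) ht0).trans hw0
    have hf1c : AEStronglyMeasurable (UnboundedOperators.heatExtension (fun y => u₀ y - V 0 y) t) volume :=
      (UnboundedOperators.contDiff_heatExtension_of_bound (m := 0) hw0c
        (fun z => (norm_sub_le _ _).trans (add_le_add (hu₀B z) (hV0B z))) ht0).continuous.aestronglyMeasurable
    have hDuh := eLpNorm_oseenDuhamel_three_le hC₂0 hS₂ hcw hcu hwB (hu3 X hX) ht0 htT ht1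
    have hDuhV := eLpNorm_oseenDuhamel_three_le hC₂0 hS₂ hcw hcV hwB
      (fun σ hσ => hV3 σ ⟨hσ.1, hσ.2.trans hT'1⟩) ht0 htT ht1
    have hf2 := hDuh.1
    have hf3 := hDuhV.2
    have hmw' := aestronglyMeasurable_of_continuousOn_slab hcw le_rfl le_rfl
    have hwB'' : ∀ τ ∈ Ioo 0 T', ∀ y, ‖u τ y - V τ y‖ ≤ BV + 2 := fun τ hτ y =>
      (hwB τ ⟨hτ.1.le, hτ.2.le⟩ y).trans (by
        have := hclose τ ⟨hτ.1.le, hτ.2.le⟩ y; linarith [hwB τ ⟨hτ.1.le, hτ.2.le⟩ y, hBV0])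
    have hf2c : AEStronglyMeasurable (oseenDuhamel 1 0 (fun τ y => u τ y - V τ y) u t) volume :=
      (continuous_oseenDuhamel_slice one_pos (by positivity : (0:ℝ) ≤ BV + 2) hmw' hmu' hwB'' huB'' ht0 htT).aestronglyMeasurable
    have hf3c : AEStronglyMeasurable (oseenDuhamel 1 0 V (fun τ y => u τ y - V τ y) t) volume :=
      (continuous_oseenDuhamel_slice one_pos (by positivity : (0:ℝ) ≤ BV + 2) hmV' hmw' hVB'' hwB'' ht0 htT).aestronglyMeasurable
    have hf4 : eLpNorm (mildDefect V t) 3 volume ≤ ENNReal.ofReal β := hD3 t ⟨ht0.le, htT.trans hT'1⟩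
    have hf4c : AEStronglyMeasurable (mildDefect V t) volume :=
      (continuous_mildDefect_slice hVc hBV0 hVB ⟨ht0, htT.trans hT'1⟩).aestronglyMeasurable
    -- assemble
    show eLpNorm (fun x => u t x - V t x) 3 volume ≤ S + q * X
    rw [hwt]
    calc eLpNorm (fun x => UnboundedOperators.heatExtension (fun y => u₀ y - V 0 y) t x -
            (oseenDuhamel 1 0 (fun τ y => u τ y - V τ y) u t x + oseenDuhamel 1 0 V (fun τ y => u τ y - V τ y) t x) -
            mildDefect V t x) 3 volume
        ≤ eLpNorm (fun x => UnboundedOperators.heatExtension (fun y => u₀ y - V 0 y) t x -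
            (oseenDuhamel 1 0 (fun τ y => u τ y - V τ y) u t x + oseenDuhamel 1 0 V (fun τ y => u τ y - V τ y) t x)) 3 volume +
          eLpNorm (mildDefect V t) 3 volume := eLpNorm_sub_le (hf1c.sub (hf2c.add hf3c)) hf4c (by norm_num)
      _ ≤ (eLpNorm (UnboundedOperators.heatExtension (fun y => u₀ y - V 0 y) t) 3 volume +
            eLpNorm (fun x => oseenDuhamel 1 0 (fun τ y => u τ y - V τ y) u t x +
              oseenDuhamel 1 0 V (fun τ y => u τ y - V τ y) t x) 3 volume) + eLpNorm (mildDefect V t) 3 volume := by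
          gcongr
          exact eLpNorm_sub_le hf1c (hf2c.add hf3c) (by norm_num)
      _ ≤ (ENNReal.ofReal β + (2 * ENNReal.ofReal C₂ * ENNReal.ofReal θs * (ENNReal.ofReal b + X) +
            2 * ENNReal.ofReal C₂ * ENNReal.ofReal θs * ENNReal.ofReal b)) + ENNReal.ofReal β :=
          add_le_add (add_le_add hf1 ((eLpNorm_add_le hf2c hf3c (by norm_num)).trans (add_le_add hf2 hf3))) hf4
      _ = S + q * X := by rw [hS, hq]; ring
  -- ### iterate and pass to the limit
  have hqhalf : q ≤ (2:ℝ≥0∞)⁻¹ := by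
    have : q = (2:ℝ≥0∞)⁻¹ * (2 * q) := by
      rw [← mul_assoc, ENNReal.inv_mul_cancel two_ne_zero ENNReal.ofNat_ne_top, one_mul]
    rw [this]
    calc (2:ℝ≥0∞)⁻¹ * (2 * q) ≤ (2:ℝ≥0∞)⁻¹ * 1 := mul_le_mul' le_rfl hq2
      _ = (2:ℝ≥0∞)⁻¹ := mul_one _
  have hiter : ∀ k : ℕ, ∀ σ ∈ Set.Icc 0 T', n σ ≤ 2 * S + ((2:ℝ≥0∞)⁻¹) ^ k * N₀ := by
    intro k
    induction k with
    | zero =>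
      intro σ hσ
      rw [pow_zero, one_mul]
      exact (hn0 σ hσ).trans le_add_self
    | succ k ih =>
      intro σ hσ
      refine (himp _ ih σ hσ).trans ?_
      have h1 : q * (2 * S + ((2:ℝ≥0∞)⁻¹) ^ k * N₀) = (2 * q) * S + q * (((2:ℝ≥0∞)⁻¹) ^ k * N₀) := by ring
      rw [h1]
      calc S + ((2 * q) * S + q * (((2:ℝ≥0∞)⁻¹) ^ k * N₀))
          ≤ S + (1 * S + (2:ℝ≥0∞)⁻¹ * (((2:ℝ≥0∞)⁻¹) ^ k * N₀)) := by gcongr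
        _ = 2 * S + ((2:ℝ≥0∞)⁻¹) ^ (k + 1) * N₀ := by rw [pow_succ]; ring
  have hlim : Tendsto (fun k : ℕ => 2 * S + ((2:ℝ≥0∞)⁻¹) ^ k * N₀) atTop (𝓝 (2 * S)) := by
    have h1 : Tendsto (fun k : ℕ => ((2:ℝ≥0∞)⁻¹) ^ k) atTop (𝓝 0) :=
      ENNReal.tendsto_pow_atTop_nhds_zero_iff.2 (ENNReal.inv_lt_one.2 ENNReal.one_lt_two)
    have h2 : Tendsto (fun k : ℕ => ((2:ℝ≥0∞)⁻¹) ^ k * N₀) atTop (𝓝 (0 * N₀)) :=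
      ENNReal.Tendsto.mul_const h1 (Or.inr hN₀top)
    rw [zero_mul] at h2
    simpa using h2.const_add (2 * S)
  have hfin : n t ≤ 2 * S := ge_of_tendsto' hlim fun k => hiter k t ht
  -- ### the real-number form of the bound
  refine hfin.trans ?_
  have c4 : (4:ℝ≥0∞) * ENNReal.ofReal β = ENNReal.ofReal (4 * β) := by
    rw [ENNReal.ofReal_mul (by norm_num), ENNReal.ofReal_ofNat]
  have cq : (4:ℝ≥0∞) * (q * ENNReal.ofReal b) = ENNReal.ofReal (8 * C₂ * θs * b) := by
    rw [hqreal, ENNReal.ofReal_mul (by positivity : (0:ℝ) ≤ 8 * C₂ * θs),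
      show (8 : ℝ) * C₂ * θs = 4 * (2 * C₂ * θs) by ring, ENNReal.ofReal_mul (by norm_num : (0:ℝ) ≤ 4), ENNReal.ofReal_ofNat]
    ring
  have e : 2 * S = ENNReal.ofReal (4 * β + 8 * C₂ * θs * b) := by
    rw [hS, ENNReal.ofReal_add (by positivity) (by positivity), ← c4, ← cq]
    ring
  rw [e]
  refine ENNReal.ofReal_le_ofReal ?_
  have h1 : 4 * β ≤ K * β := mul_le_mul_of_nonneg_right hK4 hβ
  have h8 : 8 * C₂ * θs ≤ K * θ :=
    calc 8 * C₂ * θs ≤ 8 * C₂ * θ := mul_le_mul_of_nonneg_left hθsθ (by positivity)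
      _ ≤ K * θ := mul_le_mul_of_nonneg_right hK8 hθ0
  have h2 : 8 * C₂ * θs * b ≤ K * (b * θ) :=
    calc 8 * C₂ * θs * b = (8 * C₂ * θs) * b := by ring
      _ ≤ (K * θ) * b := mul_le_mul_of_nonneg_right h8 hb
      _ = K * (b * θ) := by ring
  have e2 : K * (β + b * θ) = K * β + K * (b * θ) := by ring
  rw [e2]
  linarith

end Summit.NavierStokesRegularity.NavierStokesRegularity.Cruxes.TypeIQuantSubcubicExp.QuietCollar

end
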